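import Summits.NavierStokesRegularity.NavierStokesRegularity.Theses.RellichScar
import Summits.NavierStokesRegularity.NavierStokesRegularity.Theorems.ScarRigidity.Negative.LogicAndLoadBearing
import Literature.Analysis.FluidPDE.TypeIAncientMild
import Literature.Analysis.FluidPDE.ParasiticSlabFlow
import HarnessLib

/-!
# `ScarRigidity` — line `finite-energy-log-convexity`, stub `stub_logConvexityBelowThreshold`:
# the real-variable core of the Agmon–Nirenberg argument (crux stmt-NavierStokesRegularity-11717)

Helper file 1 of S4 (`stub_logConvexityBelowThreshold`). The log-convexity argument in
`H = Ḣ⁻¹_σ(ℝ³)` for the difference `w = V₁ - V₂` of two Type-I apex profiles only ever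
manipulates two real functions of time, the energy `N(t) = ‖w(t)‖²_H` and the Dirichlet form
`b(t) = ‖A^{1/2} w(t)‖²_H` (`A` the Stokes operator), through

* the **energy inequality** `N' ≥ -2b - (4C/√(-t)) √(bN)` (from `N' = -2b + 2⟨F, w⟩_H`,
  `‖F‖_H ≤ (2C/√(-t)) ‖A^{1/2}w‖_H`), and
* the **frequency (Riccati) law** `b'N - bN' ≤ (2C²/(-t)) bN`, i.e. `Λ' ≤ 2C²Λ/(-t)` for the
  frequency `Λ = b/N` (from `Λ' = (2/N)(-‖(A-Λ)w‖² + ⟨(A-Λ)w, F⟩) ≤ ‖F‖²/(2N)`).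

This file proves the two real-variable statements behind the threshold `2C² < 1`:

* `frequencyLaw_of_pairings` — the pointwise algebra producing the two inequalities from the
  identities `N' = -2b + 2p`, `b' = -2c + 2q` and the Cauchy–Schwarz bounds on the pairings
  `p = ⟨F, w⟩`, `q - λp = ⟨F, (A - λ)w⟩` (all Hilbert-space content enters through these bounds);
* `logConvexity_lowerBound` — **on an interval of positivity `(t₀, T)`, `T ≤ 0`, the energy is
  bounded below**: `(-t)^{2C²} Λ` is non-increasing, so `Λ ≤ M₀ (-t)^{-2C²}`, and
  `log N + G` is non-decreasing for the explicit antiderivative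
  `G(t) = -(2M₀/(1-a)) (-t)^{1-a} - (8C√M₀/(1-a)) (-t)^{(1-a)/2}`, `a = 2C²`, of the lower bound
  of `N'/N`; `G ≤ 0` is bounded exactly because `a < 1` (Agmon–Nirenberg 1967, Ogawa 1965; the
  threshold is sharp in the abstract frame, Miller 1974).

Only the mean value theorem is used (monotonicity from the sign of a derivative,
`antitoneOn_of_hasDerivWithinAt_nonpos` / `monotoneOn_of_hasDerivWithinAt_nonneg`); no
integrability of `N'` is needed.
-/

noncomputable section

open Set Filter Function MeasureTheory Metric TopologicalSpace
open scoped Topology ENNReal NNReal InnerProductSpace RealInnerProductSpace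
open Literature.Analysis.FluidPDE
open Summit.NavierStokesRegularity.NavierStokesRegularity.Theses.RellichScar
open Summit.NavierStokesRegularity.NavierStokesRegularity.Theorems.ScarRigidity.Negative

set_option linter.dupNamespace false

namespace Summit.NavierStokesRegularity.NavierStokesRegularity.Theorems.RellichScarScarRigidity

/-! ## The pointwise algebra of the frequency law -/

/-- `-2X² + 2gX ≤ g²/2` (complete the square). [folklore] -/
theorem neg_two_sq_add_le (X g : ℝ) : -2 * X ^ 2 + 2 * g * X ≤ g ^ 2 / 2 := by
  nlinarith [sq_nonneg (2 * X - g)]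

/-- **The frequency law from the pairing bounds.** With `N = ‖w‖²`, `b = ‖A^{1/2}w‖²`,
`c = ‖Aw‖²`, `p = ⟨F, w⟩`, `q = ⟨F, Aw⟩`, `g = ‖F‖` and the relative bound `g ≤ η √b`:
Cauchy–Schwarz gives `|p| ≤ g√N` and `|q - λp| = |⟨F, (A-λ)w⟩| ≤ g ‖(A-λ)w‖ = g √(c - 2λb + λ²N)`;
then `N' = -2b + 2p ≥ -2b - 2η√(bN)` and `b'N - bN' = -2‖(A-Λ)w‖²N + 2N⟨F,(A-Λ)w⟩ ≤ (η²/2) bN`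
(Agmon–Nirenberg / Ogawa). [folklore] -/
theorem frequencyLaw_of_pairings {N b c p q g η : ℝ} (hN : 0 ≤ N) (hb : 0 ≤ b) (hg : 0 ≤ g)
    (hp : |p| ≤ g * Real.sqrt N)
    (hq : ∀ l : ℝ, 0 ≤ c - 2 * l * b + l ^ 2 * N ∧
      |q - l * p| ≤ g * Real.sqrt (c - 2 * l * b + l ^ 2 * N))
    (hgη : g ≤ η * Real.sqrt b) :
    -(2 * b + 2 * η * Real.sqrt (b * N)) ≤ -2 * b + 2 * p ∧
      (-2 * c + 2 * q) * N - b * (-2 * b + 2 * p) ≤ η ^ 2 / 2 * (b * N) := by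
  have hsbN : Real.sqrt (b * N) = Real.sqrt b * Real.sqrt N := Real.sqrt_mul hb N
  constructor
  · -- `p ≥ -g√N ≥ -η√b√N`
    have h1 : -(g * Real.sqrt N) ≤ p := (abs_le.1 hp).1
    have h2 : g * Real.sqrt N ≤ η * Real.sqrt b * Real.sqrt N :=
      mul_le_mul_of_nonneg_right hgη (Real.sqrt_nonneg _)
    rw [hsbN]
    nlinarith
  · have hg2 : g ^ 2 ≤ η ^ 2 * b := by
      calc g ^ 2 ≤ (η * Real.sqrt b) ^ 2 := pow_le_pow_left₀ hg hgη 2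
        _ = η ^ 2 * b := by rw [mul_pow, Real.sq_sqrt hb]
    rcases hN.eq_or_lt with hN0 | hNpos
    · -- `N = 0` forces `b = 0`
      subst hN0
      have hb0 : b = 0 := by
        by_contra hb0
        have hbpos : 0 < b := lt_of_le_of_ne hb (Ne.symm hb0)
        have h := (hq ((c + 1) / (2 * b))).1
        have : 2 * ((c + 1) / (2 * b)) * b = c + 1 := by field_simp
        nlinarith
      subst hb0
      simp
    · -- `N > 0`: test with `λ = b/N`
      obtain ⟨hD, hql⟩ := hq (b / N)
      set D : ℝ := c - 2 * (b / N) * b + (b / N) ^ 2 * N with hD_def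
      have hDN : D * N = c * N - b ^ 2 := by
        simp only [hD_def]; field_simp; ring
      -- `X = √(cN - b²) = N √D / √N`, i.e. `N √D = √N X`
      set X : ℝ := Real.sqrt (c * N - b ^ 2) with hX
      have hX0 : 0 ≤ c * N - b ^ 2 := by rw [← hDN]; exact mul_nonneg hD hN
      have hXsq : X ^ 2 = c * N - b ^ 2 := Real.sq_sqrt hX0
      have hNsD : N * Real.sqrt D = Real.sqrt N * X := by
        have : X = Real.sqrt D * Real.sqrt N := by
          rw [hX, ← hDN]; exact Real.sqrt_mul hD N
        have hNN : Real.sqrt N * Real.sqrt N = N := Real.mul_self_sqrt hN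
        rw [this]
        calc N * Real.sqrt D = Real.sqrt N * Real.sqrt N * Real.sqrt D := by rw [hNN]
          _ = Real.sqrt N * (Real.sqrt D * Real.sqrt N) := by ring
      have hqN : q * N - b * p ≤ g * Real.sqrt N * X := by
        have h1 : q * N - b * p = (q - b / N * p) * N := by field_simp
        have h2 : (q - b / N * p) * N ≤ g * Real.sqrt D * N :=
          mul_le_mul_of_nonneg_right ((le_abs_self _).trans hql) hN
        calc q * N - b * p = (q - b / N * p) * N := h1
          _ ≤ g * Real.sqrt D * N := h2
          _ = g * (N * Real.sqrt D) := by ring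
          _ = g * Real.sqrt N * X := by rw [hNsD]; ring
      have key : (-2 * c + 2 * q) * N - b * (-2 * b + 2 * p) =
          -2 * X ^ 2 + 2 * (q * N - b * p) := by rw [hXsq]; ring
      rw [key]
      have hsq := neg_two_sq_add_le X (g * Real.sqrt N)
      have hgN : (g * Real.sqrt N) ^ 2 / 2 ≤ η ^ 2 / 2 * (b * N) := by
        rw [mul_pow, Real.sq_sqrt hN]
        nlinarith
      nlinarith [hqN, hsq, hgN]

/-! ## Powers of `-t` -/

/-- `d/dt (-t)^p = -p (-t)^{p-1}` for `t < 0`. [folklore] -/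
theorem hasDerivAt_neg_rpow {t : ℝ} (ht : t < 0) (p : ℝ) :
    HasDerivAt (fun s : ℝ => (-s) ^ p) (-p * (-t) ^ (p - 1)) t := by
  have h := (hasDerivAt_neg t).rpow_const (p := p) (Or.inl (by linarith : -t ≠ 0))
  simpa [neg_mul, one_mul] using h

/-- `√((-t)^{-a}) / √(-t) = (-t)^{(1-a)/2 - 1}` for `t < 0`. [folklore] -/
theorem sqrt_rpow_div_sqrt {t : ℝ} (ht : t < 0) (a : ℝ) :
    Real.sqrt ((-t) ^ (-a)) / Real.sqrt (-t) = (-t) ^ ((1 - a) / 2 - 1) := by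
  have hnt : 0 < -t := by linarith
  rw [Real.sqrt_eq_rpow, Real.sqrt_eq_rpow, ← Real.rpow_mul hnt.le, div_eq_mul_inv,
    ← Real.rpow_neg hnt.le, ← Real.rpow_add hnt]
  congr 1
  ring

/-! ## The lower bound on an interval of positivity -/

/-- **Monotonicity of the weighted frequency.** On an interval `(t₀, T)`, `T ≤ 0`, on which
`N > 0`, `b ≥ 0` and the frequency law `b'N - bN' ≤ (a/(-t)) bN` holds, the weighted frequency
`(-t)^a (b/N)` is non-increasing. [folklore] -/
theorem antitoneOn_rpow_mul_frequency {a t₀ T : ℝ} (hT : T ≤ 0) {N b N' b' : ℝ → ℝ}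
    (hN : ∀ t ∈ Ioo t₀ T, HasDerivAt N (N' t) t) (hb : ∀ t ∈ Ioo t₀ T, HasDerivAt b (b' t) t)
    (hNpos : ∀ t ∈ Ioo t₀ T, 0 < N t)
    (hfreq : ∀ t ∈ Ioo t₀ T, b' t * N t - b t * N' t ≤ a / (-t) * (b t * N t)) :
    AntitoneOn (fun t => (-t) ^ a * (b t / N t)) (Ioo t₀ T) := by
  have hneg : ∀ t ∈ Ioo t₀ T, t < 0 := fun t ht => lt_of_lt_of_le ht.2 hT
  have hderiv : ∀ t ∈ Ioo t₀ T, HasDerivAt (fun t => (-t) ^ a * (b t / N t))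
      (-a * (-t) ^ (a - 1) * (b t / N t) +
        (-t) ^ a * ((b' t * N t - b t * N' t) / N t ^ 2)) t := fun t ht =>
    (hasDerivAt_neg_rpow (hneg t ht) a).mul ((hb t ht).div (hN t ht) (hNpos t ht).ne')
  have hle : ∀ t ∈ Ioo t₀ T, -a * (-t) ^ (a - 1) * (b t / N t) +
      (-t) ^ a * ((b' t * N t - b t * N' t) / N t ^ 2) ≤ 0 := by
    intro t ht
    have hNt := hNpos t ht
    have hnt : 0 < -t := by linarith [hneg t ht]
    have h1 : (b' t * N t - b t * N' t) / N t ^ 2 ≤ a / (-t) * (b t / N t) := by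
      rw [div_le_iff₀ (pow_pos hNt 2)]
      calc b' t * N t - b t * N' t ≤ a / (-t) * (b t * N t) := hfreq t ht
        _ = a / (-t) * (b t / N t) * N t ^ 2 := by field_simp
    have h2 : (-t) ^ a * ((b' t * N t - b t * N' t) / N t ^ 2) ≤
        (-t) ^ a * (a / (-t) * (b t / N t)) :=
      mul_le_mul_of_nonneg_left h1 (Real.rpow_nonneg hnt.le a)
    have h3 : (-t) ^ a * (a / (-t) * (b t / N t)) = a * (-t) ^ (a - 1) * (b t / N t) := by
      rw [Real.rpow_sub_one hnt.ne']
      field_simp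
    linarith
  refine antitoneOn_of_hasDerivWithinAt_nonpos
    (f' := fun t => -a * (-t) ^ (a - 1) * (b t / N t) +
      (-t) ^ a * ((b' t * N t - b t * N' t) / N t ^ 2)) (convex_Ioo t₀ T)
    (fun t ht => (hderiv t ht).continuousAt.continuousWithinAt) ?_ ?_
  · intro t ht
    rw [interior_Ioo] at ht ⊢
    exact (hderiv t ht).hasDerivWithinAt
  · intro t ht
    rw [interior_Ioo] at ht
    exact hle t ht

/-- **Lower bound below the threshold.** Let `0 < C`, `a = 2C² < 1`, `T ≤ 0`, and let `N, b` be
differentiable on `(t₀, T)` with `N > 0`, `b ≥ 0`, the energy inequality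
`N' ≥ -(2b + (4C/√(-t)) √(bN))` and the frequency law `b'N - bN' ≤ (2C²/(-t)) bN`. Then for
every `t₁ ∈ (t₀, T)` the energy is bounded below on `[t₁, T)` by a positive constant:
`(-t)^a Λ ≤ M₀ := (-t₁)^a Λ(t₁)` by `antitoneOn_rpow_mul_frequency`, hence
`(log N)' = N'/N ≥ -2Λ - (4C/√(-t))√Λ ≥ -2M₀(-t)^{-a} - 4C√M₀ (-t)^{-(1+a)/2} = -G'`, and
`log N + G` is non-decreasing with `G ≤ 0` (the two exponents `1 - a`, `(1 - a)/2` of `G` are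
positive iff `2C² < 1`). [folklore] -/
theorem logConvexity_lowerBound {C t₀ T : ℝ} (hC : 0 < C) (hthr : 2 * C ^ 2 < 1) (hT : T ≤ 0)
    {N b N' b' : ℝ → ℝ}
    (hN : ∀ t ∈ Ioo t₀ T, HasDerivAt N (N' t) t) (hb : ∀ t ∈ Ioo t₀ T, HasDerivAt b (b' t) t)
    (hNpos : ∀ t ∈ Ioo t₀ T, 0 < N t) (hb0 : ∀ t ∈ Ioo t₀ T, 0 ≤ b t)
    (hlog : ∀ t ∈ Ioo t₀ T,
      -(2 * b t + 4 * C / Real.sqrt (-t) * Real.sqrt (b t * N t)) ≤ N' t)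
    (hfreq : ∀ t ∈ Ioo t₀ T, b' t * N t - b t * N' t ≤ 2 * C ^ 2 / (-t) * (b t * N t))
    {t₁ : ℝ} (ht₁ : t₁ ∈ Ioo t₀ T) :
    ∃ m : ℝ, 0 < m ∧ ∀ t ∈ Ico t₁ T, m ≤ N t := by
  set a : ℝ := 2 * C ^ 2 with ha_def
  have ha1 : a < 1 := hthr
  have hneg : ∀ t ∈ Ioo t₀ T, t < 0 := fun t ht => lt_of_lt_of_le ht.2 hT
  have hsub : ∀ t ∈ Ico t₁ T, t ∈ Ioo t₀ T := fun t ht => ⟨ht₁.1.trans_le ht.1, ht.2⟩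
  -- Step 1: `Λ ≤ M₀ (-t)^{-a}` on `[t₁, T)`.
  have hanti := antitoneOn_rpow_mul_frequency (a := a) hT hN hb hNpos hfreq
  set M₀ : ℝ := (-t₁) ^ a * (b t₁ / N t₁) with hM₀_def
  have hM₀ : 0 ≤ M₀ := mul_nonneg (Real.rpow_nonneg (by linarith [hneg t₁ ht₁]) a)
    (div_nonneg (hb0 t₁ ht₁) (hNpos t₁ ht₁).le)
  have hΛ : ∀ t ∈ Ico t₁ T, b t / N t ≤ M₀ * (-t) ^ (-a) := by
    intro t ht
    have hnt : 0 < -t := by linarith [hneg t (hsub t ht)]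
    have h1 : (-t) ^ a * (b t / N t) ≤ M₀ := hanti ht₁ (hsub t ht) ht.1
    have hpos : 0 < (-t) ^ a := Real.rpow_pos_of_pos hnt a
    rw [Real.rpow_neg hnt.le, ← div_eq_mul_inv, le_div_iff₀ hpos]
    linarith
  -- Step 2: the antiderivative `G` of the lower bound of `N'/N`.
  set p₁ : ℝ := 1 - a with hp₁_def
  set p₂ : ℝ := (1 - a) / 2 with hp₂_def
  have hp₁ : 0 < p₁ := by simp only [hp₁_def]; linarith
  have hp₂ : 0 < p₂ := by simp only [hp₂_def]; linarith
  set G : ℝ → ℝ := fun t =>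
    -(2 * M₀ / p₁) * (-t) ^ p₁ - (4 * C * Real.sqrt M₀ / p₂) * (-t) ^ p₂ with hG_def
  have hGderiv : ∀ t ∈ Ioo t₀ T, HasDerivAt G
      (2 * M₀ * (-t) ^ (p₁ - 1) + 4 * C * Real.sqrt M₀ * (-t) ^ (p₂ - 1)) t := by
    intro t ht
    have h1 : HasDerivAt G (-(2 * M₀ / p₁) * (-p₁ * (-t) ^ (p₁ - 1)) -
        4 * C * Real.sqrt M₀ / p₂ * (-p₂ * (-t) ^ (p₂ - 1))) t :=
      ((hasDerivAt_neg_rpow (hneg t ht) p₁).const_mul (-(2 * M₀ / p₁))).sub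
        ((hasDerivAt_neg_rpow (hneg t ht) p₂).const_mul (4 * C * Real.sqrt M₀ / p₂))
    refine h1.congr_deriv ?_
    have e1 : -(2 * M₀ / p₁) * (-p₁ * (-t) ^ (p₁ - 1)) = 2 * M₀ * (-t) ^ (p₁ - 1) := by
      calc -(2 * M₀ / p₁) * (-p₁ * (-t) ^ (p₁ - 1)) = 2 * M₀ / p₁ * p₁ * (-t) ^ (p₁ - 1) := by
            ring
        _ = 2 * M₀ * (-t) ^ (p₁ - 1) := by rw [div_mul_cancel₀ _ hp₁.ne']
    have e2 : 4 * C * Real.sqrt M₀ / p₂ * (-p₂ * (-t) ^ (p₂ - 1)) =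
        -(4 * C * Real.sqrt M₀ * (-t) ^ (p₂ - 1)) := by
      calc 4 * C * Real.sqrt M₀ / p₂ * (-p₂ * (-t) ^ (p₂ - 1))
            = -(4 * C * Real.sqrt M₀ / p₂ * p₂ * (-t) ^ (p₂ - 1)) := by ring
        _ = -(4 * C * Real.sqrt M₀ * (-t) ^ (p₂ - 1)) := by rw [div_mul_cancel₀ _ hp₂.ne']
    rw [e1, e2]
    ring
  have hGle : ∀ t ∈ Ioo t₀ T, G t ≤ 0 := by
    intro t ht
    have hnt : 0 ≤ -t := by linarith [hneg t ht]
    have h1 : 0 ≤ 2 * M₀ / p₁ * (-t) ^ p₁ := by positivity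
    have h2 : 0 ≤ 4 * C * Real.sqrt M₀ / p₂ * (-t) ^ p₂ := by positivity
    simp only [hG_def]
    linarith
  -- Step 3: `(log N)' ≥ -G'` on `[t₁, T)`.
  have hlogN : ∀ t ∈ Ico t₁ T,
      -(2 * M₀ * (-t) ^ (p₁ - 1) + 4 * C * Real.sqrt M₀ * (-t) ^ (p₂ - 1)) ≤ N' t / N t := by
    intro t ht
    have ht' := hsub t ht
    have hNt := hNpos t ht'
    have hnt : 0 < -t := by linarith [hneg t ht']
    have hΛt := hΛ t ht
    have hΛ0 : 0 ≤ b t / N t := div_nonneg (hb0 t ht') hNt.le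
    -- `√(bN)/N = √(b/N)`
    have hsq : Real.sqrt (b t * N t) / N t = Real.sqrt (b t / N t) := by
      rw [show b t * N t = b t / N t * N t ^ 2 by field_simp, Real.sqrt_mul hΛ0,
        Real.sqrt_sq hNt.le, mul_div_assoc, div_self hNt.ne', mul_one]
    -- the quotient of the energy inequality
    have h1 : -(2 * (b t / N t) + 4 * C / Real.sqrt (-t) * Real.sqrt (b t / N t)) ≤
        N' t / N t := by
      have h := div_le_div_of_nonneg_right (hlog t ht') hNt.le
      rw [neg_div, add_div, mul_div_assoc, mul_div_assoc, hsq] at h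
      exact h
    -- `Λ ≤ M₀(-t)^{-a} = M₀ (-t)^{p₁-1}` and `√Λ/√(-t) ≤ √M₀ (-t)^{p₂-1}`
    have h2 : b t / N t ≤ M₀ * (-t) ^ (p₁ - 1) := by
      have : p₁ - 1 = -a := by simp only [hp₁_def]; ring
      rwa [this]
    have h3 : Real.sqrt (b t / N t) / Real.sqrt (-t) ≤ Real.sqrt M₀ * (-t) ^ (p₂ - 1) := by
      calc Real.sqrt (b t / N t) / Real.sqrt (-t)
          ≤ Real.sqrt (M₀ * (-t) ^ (-a)) / Real.sqrt (-t) :=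
            div_le_div_of_nonneg_right (Real.sqrt_le_sqrt hΛt) (Real.sqrt_nonneg _)
        _ = Real.sqrt M₀ * (Real.sqrt ((-t) ^ (-a)) / Real.sqrt (-t)) := by
            rw [Real.sqrt_mul hM₀, mul_div_assoc]
        _ = Real.sqrt M₀ * (-t) ^ (p₂ - 1) := by rw [sqrt_rpow_div_sqrt (hneg t ht') a]
    have h4 : 4 * C / Real.sqrt (-t) * Real.sqrt (b t / N t) ≤
        4 * C * Real.sqrt M₀ * (-t) ^ (p₂ - 1) := by
      have : 4 * C / Real.sqrt (-t) * Real.sqrt (b t / N t) =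
          4 * C * (Real.sqrt (b t / N t) / Real.sqrt (-t)) := by ring
      rw [this, mul_assoc (4 * C)]
      exact mul_le_mul_of_nonneg_left h3 (by positivity)
    linarith
  -- Step 4: `log N + G` is non-decreasing on `[t₁, T)`.
  have hmono : MonotoneOn (fun t => Real.log (N t) + G t) (Ico t₁ T) := by
    have hder : ∀ t ∈ Ico t₁ T, HasDerivAt (fun t => Real.log (N t) + G t)
        (N' t / N t + (2 * M₀ * (-t) ^ (p₁ - 1) + 4 * C * Real.sqrt M₀ * (-t) ^ (p₂ - 1))) t :=
      fun t ht => ((hN t (hsub t ht)).log (hNpos t (hsub t ht)).ne').add (hGderiv t (hsub t ht))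
    refine monotoneOn_of_hasDerivWithinAt_nonneg
      (f' := fun t => N' t / N t +
        (2 * M₀ * (-t) ^ (p₁ - 1) + 4 * C * Real.sqrt M₀ * (-t) ^ (p₂ - 1))) (convex_Ico t₁ T)
      (fun t ht => (hder t ht).continuousAt.continuousWithinAt) ?_ ?_
    · intro t ht
      rw [interior_Ico] at ht ⊢
      exact (hder t (Ioo_subset_Ico_self ht)).hasDerivWithinAt
    · intro t ht
      rw [interior_Ico] at ht
      have := hlogN t (Ioo_subset_Ico_self ht)
      linarith
  -- Step 5: the bound.
  have ht₁' : t₁ ∈ Ico t₁ T := ⟨le_rfl, ht₁.2⟩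
  refine ⟨Real.exp (Real.log (N t₁) + G t₁), Real.exp_pos _, fun t ht => ?_⟩
  have h1 : Real.log (N t₁) + G t₁ ≤ Real.log (N t) + G t := hmono ht₁' ht ht.1
  have h2 : Real.log (N t₁) + G t₁ ≤ Real.log (N t) := by linarith [hGle t (hsub t ht)]
  calc Real.exp (Real.log (N t₁) + G t₁) ≤ Real.exp (Real.log (N t)) := Real.exp_le_exp.2 h2
    _ = N t := Real.exp_log (hNpos t (hsub t ht))

/-! ## Registered sub-goal (helper stub of `stub_logConvexityBelowThreshold`) -/

/-- **Registered helper stub `stub_logConvexityLowerBound`** (crux stmt-NavierStokesRegularity-11717,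
line `finite-energy-log-convexity`, helper of S4): the real-variable core of the Agmon–Nirenberg
log-convexity argument below the threshold `2C² < 1`, as registered. [folklore] -/
theorem stub_logConvexityLowerBound :
    ∀ (C t₀ T t₁ : ℝ) (N b N' b' : ℝ → ℝ), 0 < C → 2 * C ^ 2 < 1 → T ≤ 0 → t₁ ∈ Set.Ioo t₀ T →
      (∀ t ∈ Set.Ioo t₀ T, HasDerivAt N (N' t) t) → (∀ t ∈ Set.Ioo t₀ T, HasDerivAt b (b' t) t) →
      (∀ t ∈ Set.Ioo t₀ T, 0 < N t) → (∀ t ∈ Set.Ioo t₀ T, 0 ≤ b t) →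
      (∀ t ∈ Set.Ioo t₀ T, -(2 * b t + 4 * C / Real.sqrt (-t) * Real.sqrt (b t * N t)) ≤ N' t) →
      (∀ t ∈ Set.Ioo t₀ T, b' t * N t - b t * N' t ≤ 2 * C ^ 2 / (-t) * (b t * N t)) →
      ∃ m : ℝ, 0 < m ∧ ∀ t ∈ Set.Ico t₁ T, m ≤ N t :=
  fun _C _t₀ _T _t₁ _N _b _N' _b' hC hthr hT ht₁ hN hb hNpos hb0 hlog hfreq =>
    logConvexity_lowerBound hC hthr hT hN hb hNpos hb0 hlog hfreq ht₁

end Summit.NavierStokesRegularity.NavierStokesRegularity.Theorems.RellichScarScarRigidity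

end
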